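import Literature.Geometry.Riemannian.ChernTransgression
import Literature.LinearAlgebra.Matrix.MixedDiscriminant
import HarnessLib

/-!
# Chern's transgression form in dimension four: pointwise algebra and its tensoriality

Companion of `ChernTransgression.lean` (Chern's transgression form `Π` of a coordinate metric in
even dimension `d`, `chernTransgression g V i x`, with its divergence identity
`div Π = E` proved in `ChernTransgressionDivergence.lean`). Here `d = 4` and everything is
POINTWISE LINEAR ALGEBRA over a commutative ring `R` (then `ℝ`): the inputs are the arrays that
`Π` is built from at one point,

* `A : Matrix (Fin 4) (Fin 4) R` — slot `0` (for `Π` itself `A = u♭ ⊗ eᵢ`, `u♭ = g u` the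
  lowered unit field and `eᵢ` the coordinate covector singled out by the free index `i`),
* `N : Matrix (Fin 4) (Fin 4) R` — the lowered covariant derivative `N a k = (∇ₖ u)ₐ`,
* `W : Fin 4 → Fin 4 → Fin 4 → Fin 4 → R` — the covariant curvature array `R_{abkl}`,

and the outputs are Chern's two double alternating sums (Chern 1945, (4), (9); `k = 0, 1` of
`chernTransgressionSum` at `d = 4`)

* `chernPair₀ A N = ∑_{σ,τ} sgn σ sgn τ A_{σ0 τ0} N_{σ1 τ1} N_{σ2 τ2} N_{σ3 τ3}`
  (`= mixedDisc ![A, N, N, N]`, `Literature/LinearAlgebra/Matrix/MixedDiscriminant.lean`),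
* `chernPair₁ A W N = ∑_{σ,τ} sgn σ sgn τ A_{σ0 τ0} W_{σ1 σ2 τ1 τ2} N_{σ3 τ3}`,

their vector versions `chernSum₀ uL N i`, `chernSum₁ uL W N i` (`A = uL ⊗ eᵢ`), and the
assembled **Chern vector** `chernVec g uL W N i = −(det g)⁻¹ (⅓ chernSum₀ + ¼ chernSum₁)`, for
which `Πᵢ = √(det g) · chernVec … i` (`chernTransgression_four`: the coefficients
`((d−2k−1)!! 4ᵏ k!)⁻¹` are `⅓, ¼` at `d = 4`).

The point of the file is **tensoriality**: under a change of basis with matrix `P`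
(new basis `b'_j = ∑ᵢ P_{ij} bᵢ`; lowered/covariant components transform by `Pᵀ · P`,
`W` by `P` in each of its four slots — `transform₄ P W` — and contravariant components by `P⁻¹`),

* `chernPair₀_conj`, `chernPair₁_conj` — the pairings are densities of weight two:
  `chernPair (PᵀAP) (transform₄ P W) (PᵀNP) = (det P)² · chernPair A W N` (for `chernPair₀` this is
  `mixedDisc_conj`; for `chernPair₁`, by linearity in `W` it suffices to treat the elementary
  arrays `W = E^{x₁y₁} ⊗ E^{x₂y₂}`, for which the array is again a slotwise product);
* `chernSum₀_basisChange`, `chernSum₁_basisChange`, **`chernVec_basisChange`** — consequently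
  `chernVec (PᵀgP) (Pᵀu♭) (transform₄ P W) (PᵀNP) i = ∑ⱼ (P⁻¹)ᵢⱼ chernVec g u♭ W N j`: the Chern
  vector `X` with `Π = √(det g) X` is the component vector of a well-defined TANGENT VECTOR
  (equivalently, `Π` is a vector density / an intrinsic `3`-form, Chern 1945, §1), which is what
  allows `Π` to be globalised on a manifold (Chern 1944, §1: "`Π` is intrinsic").

* `pfaffPair W W'`, `pfaffPair_conj` — the Pfaffian pairing (`eulerDensitySum` at `d = 4` is
  `pfaffPair Rm Rm`, `eulerDensitySum_four`, `eulerDensity_four`) and its weight-two law, i.e.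
  the tensoriality of the coordinate Euler density.

Also: `chernTransgressionSum_four_zero/one`, `chernTransgression_four` (the dictionary with
`ChernTransgression.lean` at `d = 4`). Everything is proved; the definitions are explicit finite
sums.

## References

* S.-S. Chern, *On the curvatura integra in a Riemannian manifold*, Ann. of Math. 46 (1945)
  674–684, (4), (9) (the forms `Φₖ`, `Π`), §1 (intrinsic character). [Chern1945]
* S.-S. Chern, *A simple intrinsic proof of the Gauss–Bonnet formula for closed Riemannian
  manifolds*, Ann. of Math. 45 (1944) 747–752, §1. [Chern1944]
* R. B. Bapat, *Mixed discriminants of positive semidefinite matrices*, Linear Algebra Appl. 126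
  (1989), (1). [Bapat1989]
-/

noncomputable section

open Equiv Equiv.Perm Finset Matrix Literature.LinearAlgebra.Matrix

namespace Literature.Geometry.Riemannian

section Ring

variable {R : Type*} [CommRing R]

/-! ### Families of four matrices: `mixedDisc ![A, B, C, D]` -/

/-- The mixed discriminant of four `4 × 4` matrices, written out as a double alternating sum of
products. [cite: Bapat1989, (1)] -/
theorem mixedDisc_vec4 (A B C D : Matrix (Fin 4) (Fin 4) R) :
    mixedDisc ![A, B, C, D] = ∑ σ : Perm (Fin 4), ∑ τ : Perm (Fin 4),
      ((sign σ : ℤ) : R) * ((sign τ : ℤ) : R) *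
        (A (σ 0) (τ 0) * B (σ 1) (τ 1) * C (σ 2) (τ 2) * D (σ 3) (τ 3)) := by
  unfold mixedDisc
  refine Finset.sum_congr rfl fun σ _ ↦ Finset.sum_congr rfl fun τ _ ↦ ?_
  rw [Fin.prod_univ_four]
  simp only [Matrix.cons_val_zero, Matrix.cons_val_one, Matrix.cons_val]

/-- Conjugating the four matrices of a family. [folklore] -/
theorem vec4_conj (P A B C D : Matrix (Fin 4) (Fin 4) R) :
    (fun s ↦ Pᵀ * (![A, B, C, D] s) * P) = ![Pᵀ * A * P, Pᵀ * B * P, Pᵀ * C * P, Pᵀ * D * P] := by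
  funext s
  fin_cases s <;> rfl

/-- **Weight-two transformation law for a family of four bilinear forms**:
`mixedDisc ![PᵀAP, PᵀBP, PᵀCP, PᵀDP] = (det P)² mixedDisc ![A, B, C, D]`. [cite: Bapat1989, (1)] -/
theorem mixedDisc_vec4_conj (P A B C D : Matrix (Fin 4) (Fin 4) R) :
    mixedDisc ![Pᵀ * A * P, Pᵀ * B * P, Pᵀ * C * P, Pᵀ * D * P] =
      P.det ^ 2 * mixedDisc ![A, B, C, D] := by
  rw [← vec4_conj, mixedDisc_conj]

omit [CommRing R] in
/-- Updating slot `0` of a family of four. [folklore] -/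
theorem update_vec4_zero (A B C D X : Matrix (Fin 4) (Fin 4) R) :
    Function.update ![A, B, C, D] 0 X = ![X, B, C, D] := by
  funext s
  fin_cases s <;> rfl

/-- Additivity of `mixedDisc ![·, B, C, D]` in slot `0`. [cite: Bapat1989, (1)] -/
theorem mixedDisc_vec4_add₀ (A A' B C D : Matrix (Fin 4) (Fin 4) R) :
    mixedDisc ![A + A', B, C, D] = mixedDisc ![A, B, C, D] + mixedDisc ![A', B, C, D] := by
  rw [← update_vec4_zero A B C D (A + A'), mixedDisc_update_add, update_vec4_zero,
    update_vec4_zero]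

/-- Homogeneity of `mixedDisc ![·, B, C, D]` in slot `0`. [cite: Bapat1989, (1)] -/
theorem mixedDisc_vec4_smul₀ (c : R) (A B C D : Matrix (Fin 4) (Fin 4) R) :
    mixedDisc ![c • A, B, C, D] = c * mixedDisc ![A, B, C, D] := by
  rw [← update_vec4_zero A B C D (c • A), mixedDisc_update_smul, update_vec4_zero]

/-- Finite additivity of `mixedDisc ![·, B, C, D]` in slot `0`. [cite: Bapat1989, (1)] -/
theorem mixedDisc_vec4_sum₀ {κ : Type*} (t : Finset κ) (A : κ → Matrix (Fin 4) (Fin 4) R)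
    (B C D : Matrix (Fin 4) (Fin 4) R) :
    mixedDisc ![∑ k ∈ t, A k, B, C, D] = ∑ k ∈ t, mixedDisc ![A k, B, C, D] := by
  rw [← update_vec4_zero 0 B C D (∑ k ∈ t, A k), mixedDisc_update_sum]
  refine Finset.sum_congr rfl fun k _ ↦ ?_
  rw [update_vec4_zero]

/-! ### Chern's two pairings -/

/-- **Chern's pairing of type `k = 0`**: `∑_{σ,τ} sgn σ sgn τ A_{σ0τ0} N_{σ1τ1} N_{σ2τ2} N_{σ3τ3}`
(`= mixedDisc ![A, N, N, N]`; with `A = u♭ ⊗ θ` this is Chern's `Φ₀` paired with the covector `θ`).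
[cite: Chern1945, (4)] -/
def chernPair₀ (A N : Matrix (Fin 4) (Fin 4) R) : R :=
  mixedDisc ![A, N, N, N]

/-- `chernPair₀` written out. [cite: Chern1945, (4)] -/
theorem chernPair₀_eq_sum (A N : Matrix (Fin 4) (Fin 4) R) :
    chernPair₀ A N = ∑ σ : Perm (Fin 4), ∑ τ : Perm (Fin 4),
      ((sign σ : ℤ) : R) * ((sign τ : ℤ) : R) *
        (A (σ 0) (τ 0) * N (σ 1) (τ 1) * N (σ 2) (τ 2) * N (σ 3) (τ 3)) :=
  mixedDisc_vec4 A N N N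

/-- **Chern's pairing of type `k = 1`**:
`∑_{σ,τ} sgn σ sgn τ A_{σ0τ0} W_{σ1σ2τ1τ2} N_{σ3τ3}` (with `A = u♭ ⊗ θ`, `W = Rm`: Chern's `Φ₁`
paired with `θ`). [cite: Chern1945, (4)] -/
def chernPair₁ (A : Matrix (Fin 4) (Fin 4) R) (W : Fin 4 → Fin 4 → Fin 4 → Fin 4 → R)
    (N : Matrix (Fin 4) (Fin 4) R) : R :=
  ∑ σ : Perm (Fin 4), ∑ τ : Perm (Fin 4),
    ((sign σ : ℤ) : R) * ((sign τ : ℤ) : R) *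
      (A (σ 0) (τ 0) * W (σ 1) (σ 2) (τ 1) (τ 2) * N (σ 3) (τ 3))

/-- Additivity of `chernPair₀` in `A`. [cite: Chern1945, (4)] -/
theorem chernPair₀_add_left (A A' N : Matrix (Fin 4) (Fin 4) R) :
    chernPair₀ (A + A') N = chernPair₀ A N + chernPair₀ A' N :=
  mixedDisc_vec4_add₀ A A' N N N

/-- Homogeneity of `chernPair₀` in `A`. [cite: Chern1945, (4)] -/
theorem chernPair₀_smul_left (c : R) (A N : Matrix (Fin 4) (Fin 4) R) :
    chernPair₀ (c • A) N = c * chernPair₀ A N :=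
  mixedDisc_vec4_smul₀ c A N N N

/-- Finite additivity of `chernPair₀` in `A`. [cite: Chern1945, (4)] -/
theorem chernPair₀_sum_left {κ : Type*} (t : Finset κ) (A : κ → Matrix (Fin 4) (Fin 4) R)
    (N : Matrix (Fin 4) (Fin 4) R) :
    chernPair₀ (∑ k ∈ t, A k) N = ∑ k ∈ t, chernPair₀ (A k) N :=
  mixedDisc_vec4_sum₀ t A N N N

/-- **Weight-two transformation law for `chernPair₀`.** [cite: Chern1945, §1] -/
theorem chernPair₀_conj (P A N : Matrix (Fin 4) (Fin 4) R) :
    chernPair₀ (Pᵀ * A * P) (Pᵀ * N * P) = P.det ^ 2 * chernPair₀ A N :=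
  mixedDisc_vec4_conj P A N N N

/-- Additivity of `chernPair₁` in `A`. [cite: Chern1945, (4)] -/
theorem chernPair₁_add_left (A A' : Matrix (Fin 4) (Fin 4) R)
    (W : Fin 4 → Fin 4 → Fin 4 → Fin 4 → R) (N : Matrix (Fin 4) (Fin 4) R) :
    chernPair₁ (A + A') W N = chernPair₁ A W N + chernPair₁ A' W N := by
  simp only [chernPair₁, Matrix.add_apply, ← Finset.sum_add_distrib]
  refine Finset.sum_congr rfl fun σ _ ↦ Finset.sum_congr rfl fun τ _ ↦ ?_
  ring

/-- Homogeneity of `chernPair₁` in `A`. [cite: Chern1945, (4)] -/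
theorem chernPair₁_smul_left (c : R) (A : Matrix (Fin 4) (Fin 4) R)
    (W : Fin 4 → Fin 4 → Fin 4 → Fin 4 → R) (N : Matrix (Fin 4) (Fin 4) R) :
    chernPair₁ (c • A) W N = c * chernPair₁ A W N := by
  simp only [chernPair₁, Matrix.smul_apply, smul_eq_mul, Finset.mul_sum]
  refine Finset.sum_congr rfl fun σ _ ↦ Finset.sum_congr rfl fun τ _ ↦ ?_
  ring

/-- Finite additivity of `chernPair₁` in `A`. [cite: Chern1945, (4)] -/
theorem chernPair₁_sum_left {κ : Type*} (t : Finset κ) (A : κ → Matrix (Fin 4) (Fin 4) R)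
    (W : Fin 4 → Fin 4 → Fin 4 → Fin 4 → R) (N : Matrix (Fin 4) (Fin 4) R) :
    chernPair₁ (∑ k ∈ t, A k) W N = ∑ k ∈ t, chernPair₁ (A k) W N := by
  classical
  induction t using Finset.induction_on with
  | empty =>
    simp only [Finset.sum_empty]
    simp [chernPair₁]
  | insert k t hk ih => rw [Finset.sum_insert hk, chernPair₁_add_left, ih, Finset.sum_insert hk]

/-- Homogeneity of `chernPair₁` in `W` (pointwise scalar multiple). [cite: Chern1945, (4)] -/
theorem chernPair₁_smul_mid (A : Matrix (Fin 4) (Fin 4) R) (c : R)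
    (W : Fin 4 → Fin 4 → Fin 4 → Fin 4 → R) (N : Matrix (Fin 4) (Fin 4) R) :
    chernPair₁ A (fun a₁ a₂ b₁ b₂ ↦ c * W a₁ a₂ b₁ b₂) N = c * chernPair₁ A W N := by
  simp only [chernPair₁, Finset.mul_sum]
  refine Finset.sum_congr rfl fun σ _ ↦ Finset.sum_congr rfl fun τ _ ↦ ?_
  ring

/-- Finite additivity of `chernPair₁` in `W` (pointwise finite sum). [cite: Chern1945, (4)] -/
theorem chernPair₁_sum_mid {κ : Type*} (t : Finset κ) (A : Matrix (Fin 4) (Fin 4) R)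
    (W : κ → Fin 4 → Fin 4 → Fin 4 → Fin 4 → R) (N : Matrix (Fin 4) (Fin 4) R) :
    chernPair₁ A (fun a₁ a₂ b₁ b₂ ↦ ∑ k ∈ t, W k a₁ a₂ b₁ b₂) N =
      ∑ k ∈ t, chernPair₁ A (W k) N := by
  simp only [chernPair₁, Finset.mul_sum, Finset.sum_mul]
  exact (Finset.sum_congr rfl fun σ _ ↦ Finset.sum_comm).trans Finset.sum_comm

/-- **Slotwise-product arrays**: for `W_{a₁a₂b₁b₂} = S₁_{a₁b₁} S₂_{a₂b₂}` the pairing `chernPair₁` is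
the mixed discriminant `mixedDisc ![A, S₁, S₂, N]`. [cite: Bapat1989, (1)] -/
theorem chernPair₁_slotProd (A S₁ S₂ N : Matrix (Fin 4) (Fin 4) R) :
    chernPair₁ A (fun a₁ a₂ b₁ b₂ ↦ S₁ a₁ b₁ * S₂ a₂ b₂) N = mixedDisc ![A, S₁, S₂, N] := by
  rw [mixedDisc_vec4]
  refine Finset.sum_congr rfl fun σ _ ↦ Finset.sum_congr rfl fun τ _ ↦ ?_
  ring

/-! ### The covariant transform of a `4`-index array and the weight-two law for `chernPair₁` -/

/-- The **covariant transform** of a `4`-index array under the basis change `P`: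
`(transform₄ P W)_{a₁a₂b₁b₂} = ∑ P_{x₁a₁} P_{x₂a₂} P_{y₁b₁} P_{y₂b₂} W_{x₁x₂y₁y₂}` — how the
components `Rm(b_{a₁}, b_{a₂}, b_{b₁}, b_{b₂})` of a `4`-linear form transform when
`b'_a = ∑ₓ P_{xa} bₓ`. [folklore] -/
def transform₄ (P : Matrix (Fin 4) (Fin 4) R) (W : Fin 4 → Fin 4 → Fin 4 → Fin 4 → R) :
    Fin 4 → Fin 4 → Fin 4 → Fin 4 → R :=
  fun a₁ a₂ b₁ b₂ ↦ ∑ x₁, ∑ x₂, ∑ y₁, ∑ y₂,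
    P x₁ a₁ * P x₂ a₂ * P y₁ b₁ * P y₂ b₂ * W x₁ x₂ y₁ y₂

/-- Unfolding lemma for `transform₄`. [folklore] -/
theorem transform₄_apply (P : Matrix (Fin 4) (Fin 4) R) (W : Fin 4 → Fin 4 → Fin 4 → Fin 4 → R)
    (a₁ a₂ b₁ b₂ : Fin 4) :
    transform₄ P W a₁ a₂ b₁ b₂ = ∑ x₁, ∑ x₂, ∑ y₁, ∑ y₂,
      P x₁ a₁ * P x₂ a₂ * P y₁ b₁ * P y₂ b₂ * W x₁ x₂ y₁ y₂ := rfl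

/-- `transform₄` is homogeneous (pointwise scalar multiple). [folklore] -/
theorem transform₄_smul (P : Matrix (Fin 4) (Fin 4) R) (c : R)
    (W : Fin 4 → Fin 4 → Fin 4 → Fin 4 → R) :
    transform₄ P (fun a₁ a₂ b₁ b₂ ↦ c * W a₁ a₂ b₁ b₂) =
      fun a₁ a₂ b₁ b₂ ↦ c * transform₄ P W a₁ a₂ b₁ b₂ := by
  funext a₁ a₂ b₁ b₂
  simp only [transform₄, Finset.mul_sum]
  refine Finset.sum_congr rfl fun _ _ ↦ Finset.sum_congr rfl fun _ _ ↦
    Finset.sum_congr rfl fun _ _ ↦ Finset.sum_congr rfl fun _ _ ↦ ?_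
  ring

/-- `transform₄` is additive (pointwise finite sums). [folklore] -/
theorem transform₄_sum {κ : Type*} (t : Finset κ) (P : Matrix (Fin 4) (Fin 4) R)
    (W : κ → Fin 4 → Fin 4 → Fin 4 → Fin 4 → R) :
    transform₄ P (fun a₁ a₂ b₁ b₂ ↦ ∑ k ∈ t, W k a₁ a₂ b₁ b₂) =
      fun a₁ a₂ b₁ b₂ ↦ ∑ k ∈ t, transform₄ P (W k) a₁ a₂ b₁ b₂ := by
  funext a₁ a₂ b₁ b₂
  simp only [transform₄, Finset.mul_sum]
  refine (Finset.sum_congr rfl fun x₁ _ ↦ ?_).trans Finset.sum_comm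
  refine (Finset.sum_congr rfl fun x₂ _ ↦ ?_).trans Finset.sum_comm
  refine (Finset.sum_congr rfl fun y₁ _ ↦ ?_).trans Finset.sum_comm
  exact Finset.sum_comm

/-- Conjugating a single-entry matrix: `(Pᵀ E^{xy} P)_{ab} = P_{xa} P_{yb}`. [folklore] -/
theorem transpose_mul_single_mul_apply (P : Matrix (Fin 4) (Fin 4) R) (x y a b : Fin 4) :
    (Pᵀ * Matrix.single x y (1 : R) * P) a b = P x a * P y b := by
  rw [Matrix.mul_apply]
  have h : ∀ j, (Pᵀ * Matrix.single x y (1 : R)) a j = if j = y then P x a else 0 := by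
    intro j
    rw [Matrix.mul_apply]
    simp only [Matrix.transpose_apply, Matrix.single_apply, mul_ite, mul_one, mul_zero]
    by_cases hj : j = y
    · subst hj
      simp
    · rw [if_neg hj]
      refine Finset.sum_eq_zero fun k _ ↦ ?_
      rw [if_neg (fun h ↦ hj h.2.symm)]
  simp_rw [h]
  simp [Finset.sum_ite_eq']

/-- A fourfold Kronecker sum collapses (bound variables on the left of the conditions).
[folklore] -/
theorem sum₄_ite_and_ite_and (f : Fin 4 → Fin 4 → Fin 4 → Fin 4 → R) (a₁ a₂ b₁ b₂ : Fin 4) :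
    (∑ x₁, ∑ x₂, ∑ y₁, ∑ y₂, f x₁ x₂ y₁ y₂ *
      ((if x₁ = a₁ ∧ y₁ = b₁ then (1 : R) else 0) * (if x₂ = a₂ ∧ y₂ = b₂ then (1 : R) else 0))) =
      f a₁ a₂ b₁ b₂ := by
  rw [Finset.sum_eq_single a₁ (fun x₁ _ hx ↦ by simp [hx]) (by simp)]
  rw [Finset.sum_eq_single a₂ (fun x₂ _ hx ↦ by simp [hx]) (by simp)]
  rw [Finset.sum_eq_single b₁ (fun y₁ _ hy ↦ by simp [hy]) (by simp)]
  rw [Finset.sum_eq_single b₂ (fun y₂ _ hy ↦ by simp [hy]) (by simp)]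
  simp

/-- A fourfold Kronecker sum collapses (bound variables on the right of the conditions).
[folklore] -/
theorem sum₄_ite_and_ite_and' (f : Fin 4 → Fin 4 → Fin 4 → Fin 4 → R) (a₁ a₂ b₁ b₂ : Fin 4) :
    (∑ x₁, ∑ x₂, ∑ y₁, ∑ y₂, f x₁ x₂ y₁ y₂ *
      ((if a₁ = x₁ ∧ b₁ = y₁ then (1 : R) else 0) * (if a₂ = x₂ ∧ b₂ = y₂ then (1 : R) else 0))) =
      f a₁ a₂ b₁ b₂ := by
  rw [Finset.sum_eq_single a₁ (fun x₁ _ hx ↦ by simp [Ne.symm hx]) (by simp)]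
  rw [Finset.sum_eq_single a₂ (fun x₂ _ hx ↦ by simp [Ne.symm hx]) (by simp)]
  rw [Finset.sum_eq_single b₁ (fun y₁ _ hy ↦ by simp [Ne.symm hy]) (by simp)]
  rw [Finset.sum_eq_single b₂ (fun y₂ _ hy ↦ by simp [Ne.symm hy]) (by simp)]
  simp

/-- The **elementary arrays** `E^{x₁y₁} ⊗ E^{x₂y₂}` span: every `4`-index array is
`∑ W_{x₁x₂y₁y₂} · (E^{x₁y₁})_{a₁b₁} (E^{x₂y₂})_{a₂b₂}`. [folklore] -/
theorem sum_single_mul_single (W : Fin 4 → Fin 4 → Fin 4 → Fin 4 → R) (a₁ a₂ b₁ b₂ : Fin 4) :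
    (∑ q : Fin 4 × Fin 4 × Fin 4 × Fin 4, W q.1 q.2.1 q.2.2.1 q.2.2.2 *
      (Matrix.single q.1 q.2.2.1 (1 : R) a₁ b₁ * Matrix.single q.2.1 q.2.2.2 (1 : R) a₂ b₂)) =
      W a₁ a₂ b₁ b₂ := by
  rw [Fintype.sum_prod_type]
  simp_rw [Fintype.sum_prod_type]
  simp only [Matrix.single_apply]
  exact sum₄_ite_and_ite_and W a₁ a₂ b₁ b₂

/-- `transform₄` of an elementary array is the slotwise product of the conjugated single-entry
matrices. [folklore] -/
theorem transform₄_single_mul_single (P : Matrix (Fin 4) (Fin 4) R) (x₁ x₂ y₁ y₂ : Fin 4) :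
    transform₄ P (fun a₁ a₂ b₁ b₂ ↦
        Matrix.single x₁ y₁ (1 : R) a₁ b₁ * Matrix.single x₂ y₂ (1 : R) a₂ b₂) =
      fun a₁ a₂ b₁ b₂ ↦ (Pᵀ * Matrix.single x₁ y₁ (1 : R) * P) a₁ b₁ *
        (Pᵀ * Matrix.single x₂ y₂ (1 : R) * P) a₂ b₂ := by
  funext a₁ a₂ b₁ b₂
  rw [transpose_mul_single_mul_apply, transpose_mul_single_mul_apply, transform₄_apply]
  simp only [Matrix.single_apply]
  rw [sum₄_ite_and_ite_and' (fun p₁ p₂ q₁ q₂ ↦ P p₁ a₁ * P p₂ a₂ * P q₁ b₁ * P q₂ b₂) x₁ x₂ y₁ y₂]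
  ring

/-- **Weight-two transformation law for `chernPair₁`**:
`chernPair₁ (PᵀAP) (transform₄ P W) (PᵀNP) = (det P)² · chernPair₁ A W N`. By linearity in `W`
it suffices to treat the elementary arrays `E^{x₁y₁} ⊗ E^{x₂y₂}`, whose transforms are again
slotwise products, where the law is `mixedDisc_conj`. [cite: Chern1945, §1] -/
theorem chernPair₁_conj (P A : Matrix (Fin 4) (Fin 4) R) (W : Fin 4 → Fin 4 → Fin 4 → Fin 4 → R)
    (N : Matrix (Fin 4) (Fin 4) R) :
    chernPair₁ (Pᵀ * A * P) (transform₄ P W) (Pᵀ * N * P) = P.det ^ 2 * chernPair₁ A W N := by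
  -- expand `W` on the elementary arrays
  have hW : W = fun a₁ a₂ b₁ b₂ ↦ ∑ q : Fin 4 × Fin 4 × Fin 4 × Fin 4,
      W q.1 q.2.1 q.2.2.1 q.2.2.2 *
        (Matrix.single q.1 q.2.2.1 (1 : R) a₁ b₁ * Matrix.single q.2.1 q.2.2.2 (1 : R) a₂ b₂) := by
    funext a₁ a₂ b₁ b₂
    rw [sum_single_mul_single]
  conv_lhs => rw [hW]
  conv_rhs => rw [hW]
  rw [transform₄_sum, chernPair₁_sum_mid, chernPair₁_sum_mid, Finset.mul_sum]
  refine Finset.sum_congr rfl fun q _ ↦ ?_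
  rw [transform₄_smul, chernPair₁_smul_mid, chernPair₁_smul_mid, transform₄_single_mul_single,
    chernPair₁_slotProd, chernPair₁_slotProd, mixedDisc_vec4_conj]
  ring

/-! ### The Pfaffian pairing (Euler density) and its weight-two law -/

/-- **The Pfaffian pairing** of two `4`-index arrays:
`∑_{σ,τ} sgn σ sgn τ W_{σ0σ1τ0τ1} W'_{σ2σ3τ2τ3}`; on the diagonal `W = W' = Rm` this is the double
alternating curvature sum `eulerDensitySum` of `ChernTransgression.lean` at `d = 4`
(`eulerDensitySum_four`), i.e. `32` times the Pfaffian `Pf(Ω)` evaluated on the coordinate frame.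
[cite: Chern1945, (10)] -/
def pfaffPair (W W' : Fin 4 → Fin 4 → Fin 4 → Fin 4 → R) : R :=
  ∑ σ : Perm (Fin 4), ∑ τ : Perm (Fin 4),
    ((sign σ : ℤ) : R) * ((sign τ : ℤ) : R) *
      (W (σ 0) (σ 1) (τ 0) (τ 1) * W' (σ 2) (σ 3) (τ 2) (τ 3))

/-- Homogeneity of `pfaffPair` in its first argument. [cite: Chern1945, (10)] -/
theorem pfaffPair_smul_left (c : R) (W W' : Fin 4 → Fin 4 → Fin 4 → Fin 4 → R) :
    pfaffPair (fun a₁ a₂ b₁ b₂ ↦ c * W a₁ a₂ b₁ b₂) W' = c * pfaffPair W W' := by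
  simp only [pfaffPair, Finset.mul_sum]
  refine Finset.sum_congr rfl fun σ _ ↦ Finset.sum_congr rfl fun τ _ ↦ ?_
  ring

/-- Homogeneity of `pfaffPair` in its second argument. [cite: Chern1945, (10)] -/
theorem pfaffPair_smul_right (c : R) (W W' : Fin 4 → Fin 4 → Fin 4 → Fin 4 → R) :
    pfaffPair W (fun a₁ a₂ b₁ b₂ ↦ c * W' a₁ a₂ b₁ b₂) = c * pfaffPair W W' := by
  simp only [pfaffPair, Finset.mul_sum]
  refine Finset.sum_congr rfl fun σ _ ↦ Finset.sum_congr rfl fun τ _ ↦ ?_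
  ring

/-- Finite additivity of `pfaffPair` in its first argument. [cite: Chern1945, (10)] -/
theorem pfaffPair_sum_left {κ : Type*} (t : Finset κ) (W : κ → Fin 4 → Fin 4 → Fin 4 → Fin 4 → R)
    (W' : Fin 4 → Fin 4 → Fin 4 → Fin 4 → R) :
    pfaffPair (fun a₁ a₂ b₁ b₂ ↦ ∑ k ∈ t, W k a₁ a₂ b₁ b₂) W' = ∑ k ∈ t, pfaffPair (W k) W' := by
  simp only [pfaffPair, Finset.mul_sum, Finset.sum_mul]
  exact (Finset.sum_congr rfl fun σ _ ↦ Finset.sum_comm).trans Finset.sum_comm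

/-- Finite additivity of `pfaffPair` in its second argument. [cite: Chern1945, (10)] -/
theorem pfaffPair_sum_right {κ : Type*} (t : Finset κ) (W : Fin 4 → Fin 4 → Fin 4 → Fin 4 → R)
    (W' : κ → Fin 4 → Fin 4 → Fin 4 → Fin 4 → R) :
    pfaffPair W (fun a₁ a₂ b₁ b₂ ↦ ∑ k ∈ t, W' k a₁ a₂ b₁ b₂) = ∑ k ∈ t, pfaffPair W (W' k) := by
  simp only [pfaffPair, Finset.mul_sum]
  exact (Finset.sum_congr rfl fun σ _ ↦ Finset.sum_comm).trans Finset.sum_comm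

/-- For slotwise-product arrays the Pfaffian pairing is a mixed discriminant:
`pfaffPair (S₁ ⊗ S₂) (S₃ ⊗ S₄) = mixedDisc ![S₁, S₂, S₃, S₄]`. [cite: Bapat1989, (1)] -/
theorem pfaffPair_slotProd (S₁ S₂ S₃ S₄ : Matrix (Fin 4) (Fin 4) R) :
    pfaffPair (fun a₁ a₂ b₁ b₂ ↦ S₁ a₁ b₁ * S₂ a₂ b₂) (fun a₁ a₂ b₁ b₂ ↦ S₃ a₁ b₁ * S₄ a₂ b₂) =
      mixedDisc ![S₁, S₂, S₃, S₄] := by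
  rw [mixedDisc_vec4, pfaffPair]
  refine Finset.sum_congr rfl fun σ _ ↦ Finset.sum_congr rfl fun τ _ ↦ ?_
  ring

/-- **Weight-two transformation law for the Pfaffian pairing**:
`pfaffPair (transform₄ P W) (transform₄ P W') = (det P)² · pfaffPair W W'` — by bilinearity it
suffices to treat elementary arrays, whose transforms are slotwise products (`mixedDisc_conj`).
This is the tensoriality of the coordinate Euler density: `eulerDensitySum` is a density of
weight two, so `(√det g)⁻¹ · eulerDensitySum` transforms like `√det g`. [cite: Chern1945, (10)] -/
theorem pfaffPair_conj (P : Matrix (Fin 4) (Fin 4) R) (W W' : Fin 4 → Fin 4 → Fin 4 → Fin 4 → R) :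
    pfaffPair (transform₄ P W) (transform₄ P W') = P.det ^ 2 * pfaffPair W W' := by
  have hW : W = fun a₁ a₂ b₁ b₂ ↦ ∑ q : Fin 4 × Fin 4 × Fin 4 × Fin 4,
      W q.1 q.2.1 q.2.2.1 q.2.2.2 *
        (Matrix.single q.1 q.2.2.1 (1 : R) a₁ b₁ * Matrix.single q.2.1 q.2.2.2 (1 : R) a₂ b₂) := by
    funext a₁ a₂ b₁ b₂
    rw [sum_single_mul_single]
  have hW' : W' = fun a₁ a₂ b₁ b₂ ↦ ∑ q : Fin 4 × Fin 4 × Fin 4 × Fin 4,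
      W' q.1 q.2.1 q.2.2.1 q.2.2.2 *
        (Matrix.single q.1 q.2.2.1 (1 : R) a₁ b₁ * Matrix.single q.2.1 q.2.2.2 (1 : R) a₂ b₂) := by
    funext a₁ a₂ b₁ b₂
    rw [sum_single_mul_single]
  conv_lhs => rw [hW, hW']
  conv_rhs => rw [hW, hW']
  rw [transform₄_sum, transform₄_sum, pfaffPair_sum_left, pfaffPair_sum_left, Finset.mul_sum]
  refine Finset.sum_congr rfl fun q _ ↦ ?_
  rw [pfaffPair_sum_right, pfaffPair_sum_right, Finset.mul_sum]
  refine Finset.sum_congr rfl fun q' _ ↦ ?_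
  rw [transform₄_smul, transform₄_smul, pfaffPair_smul_left, pfaffPair_smul_left,
    pfaffPair_smul_right, pfaffPair_smul_right, transform₄_single_mul_single,
    transform₄_single_mul_single, pfaffPair_slotProd, pfaffPair_slotProd, mixedDisc_vec4_conj]
  ring

/-! ### The vector versions: `A = u♭ ⊗ eᵢ` -/

/-- **Chern's sum `T₀(i)`**: `∑_{σ,τ : τ0 = i} sgn σ sgn τ u♭_{σ0} N_{σ1τ1} N_{σ2τ2} N_{σ3τ3}`
(`chernTransgressionSum` at `d = 4`, `k = 0`; `chernTransgressionSum_four_zero`).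
[cite: Chern1945, (4)] -/
def chernSum₀ (uL : Fin 4 → R) (N : Matrix (Fin 4) (Fin 4) R) (i : Fin 4) : R :=
  chernPair₀ (vecMulVec uL (Pi.single i 1)) N

/-- **Chern's sum `T₁(i)`**: `∑_{σ,τ : τ0 = i} sgn σ sgn τ u♭_{σ0} W_{σ1σ2τ1τ2} N_{σ3τ3}`
(`chernTransgressionSum` at `d = 4`, `k = 1`; `chernTransgressionSum_four_one`).
[cite: Chern1945, (4)] -/
def chernSum₁ (uL : Fin 4 → R) (W : Fin 4 → Fin 4 → Fin 4 → Fin 4 → R)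
    (N : Matrix (Fin 4) (Fin 4) R) (i : Fin 4) : R :=
  chernPair₁ (vecMulVec uL (Pi.single i 1)) W N

/-- `chernSum₀` written out with the Kronecker factor `[τ 0 = i]`. [cite: Chern1945, (4)] -/
theorem chernSum₀_eq_sum (uL : Fin 4 → R) (N : Matrix (Fin 4) (Fin 4) R) (i : Fin 4) :
    chernSum₀ uL N i = ∑ σ : Perm (Fin 4), ∑ τ : Perm (Fin 4),
      if τ 0 = i then ((sign σ : ℤ) : R) * ((sign τ : ℤ) : R) *
        (uL (σ 0) * (N (σ 1) (τ 1) * N (σ 2) (τ 2) * N (σ 3) (τ 3))) else 0 := by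
  rw [chernSum₀, chernPair₀_eq_sum]
  refine Finset.sum_congr rfl fun σ _ ↦ Finset.sum_congr rfl fun τ _ ↦ ?_
  rw [vecMulVec_apply, Pi.single_apply]
  split_ifs <;> ring

/-- `chernSum₁` written out with the Kronecker factor `[τ 0 = i]`. [cite: Chern1945, (4)] -/
theorem chernSum₁_eq_sum (uL : Fin 4 → R) (W : Fin 4 → Fin 4 → Fin 4 → Fin 4 → R)
    (N : Matrix (Fin 4) (Fin 4) R) (i : Fin 4) :
    chernSum₁ uL W N i = ∑ σ : Perm (Fin 4), ∑ τ : Perm (Fin 4),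
      if τ 0 = i then ((sign σ : ℤ) : R) * ((sign τ : ℤ) : R) *
        (uL (σ 0) * W (σ 1) (σ 2) (τ 1) (τ 2) * N (σ 3) (τ 3)) else 0 := by
  rw [chernSum₁, chernPair₁]
  refine Finset.sum_congr rfl fun σ _ ↦ Finset.sum_congr rfl fun τ _ ↦ ?_
  rw [vecMulVec_apply, Pi.single_apply]
  split_ifs <;> ring

/-- Conjugating an outer product: `Pᵀ (u ⊗ v) P = (Pᵀu) ⊗ (Pᵀv)`. [folklore] -/
theorem transpose_mul_vecMulVec_mul (P : Matrix (Fin 4) (Fin 4) R) (u v : Fin 4 → R) :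
    Pᵀ * vecMulVec u v * P = vecMulVec (Pᵀ *ᵥ u) (Pᵀ *ᵥ v) := by
  ext a b
  simp only [Matrix.mul_apply, vecMulVec_apply, Matrix.transpose_apply, Matrix.mulVec,
    dotProduct, Finset.sum_mul, Finset.mul_sum]
  refine Finset.sum_congr rfl fun x _ ↦ Finset.sum_congr rfl fun y _ ↦ ?_
  ring

/-- The outer product is additive in its second factor. [folklore] -/
theorem vecMulVec_sum_right {κ : Type*} (t : Finset κ) (u : Fin 4 → R) (v : κ → Fin 4 → R) :
    vecMulVec u (∑ k ∈ t, v k) = ∑ k ∈ t, vecMulVec u (v k) := by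
  ext a b
  simp [vecMulVec_apply, Finset.sum_apply, Finset.mul_sum, Matrix.sum_apply]

/-- The outer product is homogeneous in its second factor. [folklore] -/
theorem vecMulVec_smul_right (c : R) (u v : Fin 4 → R) :
    vecMulVec u (c • v) = c • vecMulVec u v := by
  ext a b
  simp only [vecMulVec_apply, Pi.smul_apply, smul_eq_mul, Matrix.smul_apply]
  ring

/-- A vector expanded on the coordinate vectors: `v = ∑ⱼ vⱼ eⱼ`. [folklore] -/
theorem eq_sum_smul_single (v : Fin 4 → R) : v = ∑ j, v j • (Pi.single j (1 : R) : Fin 4 → R) := by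
  funext a
  simp [Finset.sum_apply, Pi.single_apply]

variable {P : Matrix (Fin 4) (Fin 4) R}

/-- For invertible `P`, the new coordinate covector `eᵢ` is `Pᵀ` of the vector with components
`(P⁻¹)ᵢⱼ`: `Pᵀ (P⁻¹ᵀ eᵢ) = eᵢ`. [folklore] -/
theorem transpose_mulVec_inv_transpose_mulVec (hP : IsUnit P.det) (w : Fin 4 → R) :
    Pᵀ *ᵥ (P⁻¹ᵀ *ᵥ w) = w := by
  rw [Matrix.mulVec_mulVec, ← Matrix.transpose_mul, Matrix.nonsing_inv_mul _ hP,
    Matrix.transpose_one, Matrix.one_mulVec]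

/-- The components of `P⁻¹ᵀ eᵢ` are the `i`-th row of `P⁻¹`. [folklore] -/
theorem inv_transpose_mulVec_single (i : Fin 4) :
    P⁻¹ᵀ *ᵥ (Pi.single i (1 : R)) = fun j ↦ P⁻¹ i j := by
  funext j
  simp [Matrix.mulVec, dotProduct, Matrix.transpose_apply, Pi.single_apply]

/-- **Transformation law of Chern's sum `T₀`**: a weight-two density times a vector,
`T₀'(i) = (det P)² ∑ⱼ (P⁻¹)ᵢⱼ T₀(j)` under `u♭ ↦ Pᵀu♭`, `N ↦ PᵀNP`. [cite: Chern1945, §1] -/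
theorem chernSum₀_basisChange (hP : IsUnit P.det) (uL : Fin 4 → R) (N : Matrix (Fin 4) (Fin 4) R)
    (i : Fin 4) :
    chernSum₀ (Pᵀ *ᵥ uL) (Pᵀ * N * P) i = P.det ^ 2 * ∑ j, P⁻¹ i j * chernSum₀ uL N j := by
  unfold chernSum₀
  have hA : vecMulVec (Pᵀ *ᵥ uL) (Pi.single i (1 : R)) =
      Pᵀ * vecMulVec uL (P⁻¹ᵀ *ᵥ Pi.single i (1 : R)) * P := by
    rw [transpose_mul_vecMulVec_mul, transpose_mulVec_inv_transpose_mulVec hP]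
  rw [hA, chernPair₀_conj, inv_transpose_mulVec_single,
    eq_sum_smul_single (fun j ↦ P⁻¹ i j), vecMulVec_sum_right, chernPair₀_sum_left]
  congr 1
  refine Finset.sum_congr rfl fun j _ ↦ ?_
  rw [vecMulVec_smul_right, chernPair₀_smul_left]

/-- **Transformation law of Chern's sum `T₁`**: `T₁'(i) = (det P)² ∑ⱼ (P⁻¹)ᵢⱼ T₁(j)` under
`u♭ ↦ Pᵀu♭`, `W ↦ transform₄ P W`, `N ↦ PᵀNP`. [cite: Chern1945, §1] -/
theorem chernSum₁_basisChange (hP : IsUnit P.det) (uL : Fin 4 → R)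
    (W : Fin 4 → Fin 4 → Fin 4 → Fin 4 → R) (N : Matrix (Fin 4) (Fin 4) R) (i : Fin 4) :
    chernSum₁ (Pᵀ *ᵥ uL) (transform₄ P W) (Pᵀ * N * P) i =
      P.det ^ 2 * ∑ j, P⁻¹ i j * chernSum₁ uL W N j := by
  unfold chernSum₁
  have hA : vecMulVec (Pᵀ *ᵥ uL) (Pi.single i (1 : R)) =
      Pᵀ * vecMulVec uL (P⁻¹ᵀ *ᵥ Pi.single i (1 : R)) * P := by
    rw [transpose_mul_vecMulVec_mul, transpose_mulVec_inv_transpose_mulVec hP]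
  rw [hA, chernPair₁_conj, inv_transpose_mulVec_single,
    eq_sum_smul_single (fun j ↦ P⁻¹ i j), vecMulVec_sum_right, chernPair₁_sum_left]
  congr 1
  refine Finset.sum_congr rfl fun j _ ↦ ?_
  rw [vecMulVec_smul_right, chernPair₁_smul_left]

end Ring

/-! ### The Chern vector and its tensoriality (over `ℝ`) -/

section Real

/-- **The Chern vector** `X` of the data `(g, u♭, Rm, ∇u♭)` at a point, the contravariant
components `Xⁱ = −(det g)⁻¹ (⅓ T₀(i) + ¼ T₁(i))`; Chern's transgression vector density is
`Πⁱ = √(det g) Xⁱ` (`chernTransgression_four`). [cite: Chern1945, (9)] -/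
def chernVec (g : Matrix (Fin 4) (Fin 4) ℝ) (uL : Fin 4 → ℝ) (W : Fin 4 → Fin 4 → Fin 4 → Fin 4 → ℝ)
    (N : Matrix (Fin 4) (Fin 4) ℝ) (i : Fin 4) : ℝ :=
  -((g.det)⁻¹ * ((3 : ℝ)⁻¹ * chernSum₀ uL N i + (4 : ℝ)⁻¹ * chernSum₁ uL W N i))

/-- Unfolding lemma for `chernVec`. [cite: Chern1945, (9)] -/
theorem chernVec_apply (g : Matrix (Fin 4) (Fin 4) ℝ) (uL : Fin 4 → ℝ)
    (W : Fin 4 → Fin 4 → Fin 4 → Fin 4 → ℝ) (N : Matrix (Fin 4) (Fin 4) ℝ) (i : Fin 4) :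
    chernVec g uL W N i =
      -((g.det)⁻¹ * ((3 : ℝ)⁻¹ * chernSum₀ uL N i + (4 : ℝ)⁻¹ * chernSum₁ uL W N i)) := rfl

/-- **Tensoriality of the Chern vector**: under a change of basis with invertible matrix `P`
(`g ↦ PᵀgP`, `u♭ ↦ Pᵀu♭`, `W ↦ transform₄ P W`, `N ↦ PᵀNP`) the Chern vector transforms as the
component vector of a tangent vector, `X'ⁱ = ∑ⱼ (P⁻¹)ᵢⱼ Xʲ` — Chern's "the form `Π` is
intrinsic" at `d = 4`. [cite: Chern1945, §1] -/
theorem chernVec_basisChange {P : Matrix (Fin 4) (Fin 4) ℝ} (hP : P.det ≠ 0)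
    (g : Matrix (Fin 4) (Fin 4) ℝ) (uL : Fin 4 → ℝ) (W : Fin 4 → Fin 4 → Fin 4 → Fin 4 → ℝ)
    (N : Matrix (Fin 4) (Fin 4) ℝ) (i : Fin 4) :
    chernVec (Pᵀ * g * P) (Pᵀ *ᵥ uL) (transform₄ P W) (Pᵀ * N * P) i =
      ∑ j, P⁻¹ i j * chernVec g uL W N j := by
  have hPu : IsUnit P.det := isUnit_iff_ne_zero.2 hP
  have hP2 : P.det ^ 2 ≠ 0 := pow_ne_zero 2 hP
  have hdet : (Pᵀ * g * P).det = P.det ^ 2 * g.det := by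
    rw [Matrix.det_mul, Matrix.det_mul, Matrix.det_transpose]
    ring
  rw [chernVec_apply, chernSum₀_basisChange hPu, chernSum₁_basisChange hPu, hdet]
  simp only [chernVec_apply]
  set S₀ := ∑ j, P⁻¹ i j * chernSum₀ uL N j with hS₀
  set S₁ := ∑ j, P⁻¹ i j * chernSum₁ uL W N j with hS₁
  have key : -((P.det ^ 2 * g.det)⁻¹ * (3⁻¹ * (P.det ^ 2 * S₀) + 4⁻¹ * (P.det ^ 2 * S₁))) =
      -(g.det⁻¹ * (3⁻¹ * S₀ + 4⁻¹ * S₁)) := by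
    rw [mul_inv]
    field_simp
  rw [key, hS₀, hS₁]
  conv_lhs => rw [Finset.mul_sum, Finset.mul_sum, ← Finset.sum_add_distrib, Finset.mul_sum,
    ← Finset.sum_neg_distrib]
  refine Finset.sum_congr rfl fun j _ ↦ ?_
  ring

/-! ### Dictionary with `ChernTransgression.lean` at `d = 4` -/

variable (g : (Fin 4 → ℝ) → Matrix (Fin 4) (Fin 4) ℝ) (V : (Fin 4 → ℝ) → (Fin 4 → ℝ))
  (x : Fin 4 → ℝ)

/-- The coefficient `c₀ = ((4−1)!!)⁻¹ = ⅓` at `d = 4`. [cite: Chern1945, (9)] -/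
theorem chernTransgressionCoeff_four_zero : chernTransgressionCoeff 4 0 = (3 : ℝ)⁻¹ := by
  rw [chernTransgressionCoeff_zero]
  norm_num [Nat.doubleFactorial]

/-- The coefficient `c₁ = ((4−2−1)!! · 4 · 1!)⁻¹ = ¼` at `d = 4`. [cite: Chern1945, (9)] -/
theorem chernTransgressionCoeff_four_one : chernTransgressionCoeff 4 1 = (4 : ℝ)⁻¹ := by
  norm_num [chernTransgressionCoeff, Nat.doubleFactorial]

/-- The transgression sum `T₀(i)` of `ChernTransgression.lean` at `d = 4` is `chernSum₀` of the
pointwise data `u♭ = g u`, `N = covDerivUnitField`. [cite: Chern1945, (4)] -/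
theorem chernTransgressionSum_four_zero (i : Fin 4) :
    chernTransgressionSum g V x (0 : Fin (4 / 2)) i =
      chernSum₀ (g x *ᵥ unitField g V x) (Matrix.of (covDerivUnitField g V x)) i := by
  rw [chernSum₀_eq_sum, chernTransgressionSum]
  refine Finset.sum_congr rfl fun σ _ ↦ Finset.sum_congr rfl fun τ _ ↦ ?_
  have h0 : (tgZero (0 : Fin (4 / 2)) : Fin 4) = 0 := rfl
  simp only [h0]
  split_ifs with hτ
  · have hfilter : (univ.filter fun s : Fin 4 ↦ 2 * ((0 : Fin (4 / 2)) : ℕ) + 1 ≤ (s : ℕ)) =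
        {1, 2, 3} := by decide
    have hempty : (∏ m : Fin ((0 : Fin (4 / 2)) : ℕ), coordRiemann g x
        (σ (tgPairFst (0 : Fin (4 / 2)) m)) (σ (tgPairSnd (0 : Fin (4 / 2)) m))
        (τ (tgPairFst (0 : Fin (4 / 2)) m)) (τ (tgPairSnd (0 : Fin (4 / 2)) m))) = 1 :=
      Fin.prod_univ_zero _
    rw [hfilter, hempty]
    simp [Finset.prod_insert, Matrix.of_apply]
    ring
  · rfl

/-- The transgression sum `T₁(i)` of `ChernTransgression.lean` at `d = 4` is `chernSum₁` of the
pointwise data `u♭ = g u`, `W = coordRiemann`, `N = covDerivUnitField`. [cite: Chern1945, (4)] -/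
theorem chernTransgressionSum_four_one (i : Fin 4) :
    chernTransgressionSum g V x (1 : Fin (4 / 2)) i =
      chernSum₁ (g x *ᵥ unitField g V x) (coordRiemann g x) (Matrix.of (covDerivUnitField g V x))
        i := by
  rw [chernSum₁_eq_sum, chernTransgressionSum]
  refine Finset.sum_congr rfl fun σ _ ↦ Finset.sum_congr rfl fun τ _ ↦ ?_
  have h0 : (tgZero (1 : Fin (4 / 2)) : Fin 4) = 0 := rfl
  simp only [h0]
  split_ifs with hτ
  · have hfilter : (univ.filter fun s : Fin 4 ↦ 2 * ((1 : Fin (4 / 2)) : ℕ) + 1 ≤ (s : ℕ)) =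
        {3} := by decide
    have hprod : (∏ m : Fin ((1 : Fin (4 / 2)) : ℕ), coordRiemann g x
        (σ (tgPairFst (1 : Fin (4 / 2)) m)) (σ (tgPairSnd (1 : Fin (4 / 2)) m))
        (τ (tgPairFst (1 : Fin (4 / 2)) m)) (τ (tgPairSnd (1 : Fin (4 / 2)) m))) =
        coordRiemann g x (σ 1) (σ 2) (τ 1) (τ 2) :=
      (Fin.prod_univ_one _).trans rfl
    rw [hfilter, hprod, Finset.prod_singleton, Matrix.of_apply]
    ring
  · rfl

/-- The double alternating curvature sum of `ChernTransgression.lean` at `d = 4` is the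
Pfaffian pairing of the covariant curvature array with itself. [cite: Chern1945, (10)] -/
theorem eulerDensitySum_four :
    eulerDensitySum g x = pfaffPair (coordRiemann g x) (coordRiemann g x) := by
  rw [eulerDensitySum, pfaffPair]
  refine Finset.sum_congr rfl fun σ _ ↦ Finset.sum_congr rfl fun τ _ ↦ ?_
  have hprod : (∏ m : Fin (4 / 2), coordRiemann g x (σ (pairFst m)) (σ (pairSnd m))
      (τ (pairFst m)) (τ (pairSnd m))) =
      coordRiemann g x (σ 0) (σ 1) (τ 0) (τ 1) * coordRiemann g x (σ 2) (σ 3) (τ 2) (τ 3) :=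
    (Fin.prod_univ_two _).trans rfl
  rw [hprod]

/-- **The Euler density at `d = 4`**: `E(x) = (32 √det g(x))⁻¹ · pfaffPair Rm Rm`.
[cite: Chern1945, (10)] -/
theorem eulerDensity_four :
    eulerDensity g x = ((32 : ℝ) * Real.sqrt (g x).det)⁻¹ *
      pfaffPair (coordRiemann g x) (coordRiemann g x) := by
  rw [eulerDensity, eulerDensitySum_four]
  have h2 : ((Nat.factorial (4 / 2) : ℕ) : ℝ) = 2 := by norm_num [Nat.factorial]
  have h4 : (4 : ℝ) ^ (4 / 2) = 16 := by norm_num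
  rw [h2, h4]
  ring

/-- **Dictionary at `d = 4`**: Chern's transgression vector density is `√(det g)` times the Chern
vector of the pointwise data, `Πᵢ(x) = √(det g(x)) · chernVec (g x) (g u) (Rm) (∇u♭) i`
(valid where `det g(x) > 0`). [cite: Chern1945, (9)] -/
theorem chernTransgression_four (hdet : 0 < (g x).det) (i : Fin 4) :
    chernTransgression g V i x = Real.sqrt (g x).det *
      chernVec (g x) (g x *ᵥ unitField g V x) (coordRiemann g x)
        (Matrix.of (covDerivUnitField g V x)) i := by
  rw [chernTransgression_def, chernVec_apply, Fin.sum_univ_two]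
  have h0 : ((0 : Fin (4 / 2)) : ℕ) = 0 := rfl
  have h1 : ((1 : Fin (4 / 2)) : ℕ) = 1 := rfl
  simp only [h0, h1, chernTransgressionCoeff_four_zero, chernTransgressionCoeff_four_one,
    chernTransgressionSum_four_zero, chernTransgressionSum_four_one]
  have hs : Real.sqrt (g x).det ≠ 0 := (Real.sqrt_pos.2 hdet).ne'
  have hsq : Real.sqrt (g x).det ^ 2 = (g x).det := Real.sq_sqrt hdet.le
  have hinv : ((g x).det)⁻¹ = (Real.sqrt (g x).det)⁻¹ * (Real.sqrt (g x).det)⁻¹ := by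
    rw [← mul_inv, ← sq, hsq]
  rw [hinv]
  field_simp

end Real

end Literature.Geometry.Riemannian

end
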